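/-
Copyright (c) 2026 the pub-hodgecm-mathlib formalisation cell (harness21).  Prover seat hodgecm-mathlib-F0P3b-p01 (g11), 2026-09-01.  Road «S3-tree» (census «S3» v3, architect
A-p16 (g29) A-61), brick T3′ «depth-zero κ-transfer», organ O7 of the holder's DESIGN v1 (`F0/P3/F0P3b-p01/g11/T3prime-DESIGN.v1.F0P3bp01g11.md`): the ring structure of
`O[γ] ⊂ Kⁿ`, the TRANSPORT of the self-duality criterion of a cyclic lattice along `a ↦ c•a`, and «`O[γ]·a` depends on `a` only modulo `O[γ]^×`».
-/
import Literature.NumberTheory.Automorphic.SplitTorusOrderTraceDual   -- ★ O6 (this seat): `eval_mem_span_pow`, `mul_nodalDeriv_mem_span_iff`, `gram_cyclic_integral_iff`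
import HarnessLib

/-!
# Cyclic lattices `O[γ]·a ⊂ Kⁿ`: the order `O[γ]` is a ring, the self-duality criterion transports along `a ↦ c • a`, and `O[γ]·a` depends on `a` modulo `O[γ]^×`

Topic `NumberTheory/Automorphic`; namespace `Literature.NumberTheory.Automorphic`.  THEOREMS ONLY (no definition, no instance, no notation, no named fact, no `sorry`);
imports ★ `SplitTorusOrderTraceDual` (O6) only; any field `K`, any subring `O ≤ K`, any `n`.  Cell `pub/hodgecm-mathlib`, crux H413 = `stmt-HodgeConjecture-24833`; road
«S3-tree», brick T3′, organ O7 of DESIGN v1 §2 (the TORSOR structure of the self-dual cyclic `O_w[γ]`-lattices).  HONEST LABEL: HC_CM is proved only modulo the cell's 2 remaining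
named inputs (hLiu418, h413) until rung 0 closes; elementary algebra, asserts nothing printed.

THE MATHEMATICS.  `γ : Fin n → K` with `γ i ∈ O`; `R = O[γ] := span_O {(γ_i^j)_i : j < n} ⊂ Kⁿ` (INLINE, as in ★ O6); `f′(γ_i) = ∏_{j≠i}(γ_i − γ_j)`.
* §1 `R` IS A RING inside `Kⁿ` (componentwise product): `exists_poly_of_mem_span_pow` (elements are values `(p(γ_i))_i`, `p ∈ O[X]`), `apply_mem_of_mem_span_pow` (`R ⊆ Oⁿ`),
  `one_mem_span_pow`, `mul_mem_span_pow`, `pow_mem_span_pow`, `eval_mem_span_pow_of_mem` (`P(x) ∈ R` for `x ∈ R`, `P ∈ O[X]`), and **`inv_mem_span_pow`**: an `x ∈ R` whose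
  components are units of `O` has `x⁻¹ ∈ R` (`x⁻¹ = −g(0)⁻¹ h(x)` for `g = ∏ (X − x_i) = X·h + g(0)`) — so `R^× = R ∩ (O^×)ⁿ`.
* §2 TRANSPORT.  By ★ O6 `gram_cyclic_integral_iff` the cyclic lattice `R·a` is self-dual for `diag(d)` iff the CRITERION VECTOR `T(a) := (d_i a_i σ(a_i) f′(γ_i))_i` lies in `R^×`.
  `criterion_smul`: `T(c•a) = N(c)·T(a)`, `N(c) = (c_i σ(c_i))_i`; `criterion_mem_of_norm_mem`: `T(a) ∈ R`, `N(c) ∈ R` ⇒ `T(c•a) ∈ R`; `norm_div_mem_of_criterion_mem`: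
  `T(a) ∈ R^×`, `T(a′) ∈ R` ⇒ `N(a′∕a) ∈ R` — the good set `{a | T(a) ∈ R^×}` is ONE coset of `C := {c | N(c) ∈ R^×}` (or empty).
* §3 THE LATTICE AS A FUNCTION OF `a`: `span_pow_mul_eq_map` (`R·a = R.map (·*a)`), `span_pow_mul_eq_of_unit` (`R·(u a) = R·a` for `u ∈ R^×`), `div_mem_span_pow_of_span_eq`
  (`R·a = R·a′`, `a_i ≠ 0` ⇒ `a′∕a ∈ R`, hence `∈ R^×` by symmetry).
Consumer (O8, with O1–O5 of F0P3-p02 ∕ A-p19 ∕ A-p12): `#{self-dual cyclic O_w[γ]-lattices} = [C : R^×]` on the parity class, `0` elsewhere.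

## References
* [SerreLocalFields1979] J.-P. Serre, *Local Fields* (1979), Ch. III §6 (orders `A[x]`, Euler's lemma, the trace dual).
* [Jacobowitz1962] R. Jacobowitz, *Hermitian forms over local fields*, Amer. J. Math. 84 (1962), §4 (Gram matrices, scaling of hermitian lattices).
* [Rogawski1990] J. D. Rogawski, *Automorphic Representations of Unitary Groups in Three Variables* (1990), §4.9 p. 54.
-/

set_option autoImplicit false

open Polynomial Finset Matrix

namespace Literature.NumberTheory.Automorphic

/-! ## §1 `O[γ]` is a ring: polynomial calculus inside `R = span_O {γ^j}` -/

section Ring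

variable {K : Type*} [Field K] {n : ℕ} (O : Subring K) {γ : Fin n → K}

/-- Elements of `O[γ]` are values of `O`-polynomials of degree `< n` at the nodes. [cite: SerreLocalFields1979, Ch. III §6] -/
theorem exists_poly_of_mem_span_pow {x : Fin n → K} (hx : x ∈ Submodule.span O (Set.range fun j : Fin n => fun i => γ i ^ (j : ℕ))) :
    ∃ p : O[X], ∀ i, (p.map O.subtype).eval (γ i) = x i := by
  obtain ⟨c, hc⟩ := (Submodule.mem_span_range_iff_exists_fun O).1 hx
  refine ⟨∑ j : Fin n, Polynomial.C (c j) * X ^ (j : ℕ), fun i => ?_⟩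
  · have := congrFun hc i
    simp only [Finset.sum_apply, Pi.smul_apply, Subring.smul_def, smul_eq_mul] at this
    rw [Polynomial.map_sum, eval_finsetSum, ← this]
    exact Finset.sum_congr rfl fun j _ => by simp

/-- `O[γ] ⊆ Oⁿ`: every component of an element of `O[γ]` lies in `O` (the nodes are in `O`). [cite: SerreLocalFields1979, Ch. III §6] -/
theorem apply_mem_of_mem_span_pow (hγ : ∀ i, γ i ∈ O) {x : Fin n → K}
    (hx : x ∈ Submodule.span O (Set.range fun j : Fin n => fun i => γ i ^ (j : ℕ))) (i : Fin n) : x i ∈ O := by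
  obtain ⟨p, hp⟩ := exists_poly_of_mem_span_pow O hx
  rw [← hp i, Polynomial.eval_map]
  have : Polynomial.eval₂ O.subtype (γ i) p = O.subtype (Polynomial.eval ⟨γ i, hγ i⟩ p) := by
    rw [← Polynomial.eval₂_at_apply]; rfl
  rw [this]
  exact SetLike.coe_mem _

/-- `1 ∈ O[γ]`. [cite: SerreLocalFields1979, Ch. III §6] -/
theorem one_mem_span_pow (hγ : ∀ i, γ i ∈ O) : (1 : Fin n → K) ∈ Submodule.span O (Set.range fun j : Fin n => fun i => γ i ^ (j : ℕ)) := by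
  have h := eval_mem_span_pow O hγ (γ := γ) 1
  have h1 : (fun i => ((1 : O[X]).map O.subtype).eval (γ i)) = (1 : Fin n → K) := by
    funext i; simp
  rwa [h1] at h

/-- `O[γ]` is closed under the componentwise product. [cite: SerreLocalFields1979, Ch. III §6] -/
theorem mul_mem_span_pow (hγ : ∀ i, γ i ∈ O) {x y : Fin n → K}
    (hx : x ∈ Submodule.span O (Set.range fun j : Fin n => fun i => γ i ^ (j : ℕ)))
    (hy : y ∈ Submodule.span O (Set.range fun j : Fin n => fun i => γ i ^ (j : ℕ))) :
    x * y ∈ Submodule.span O (Set.range fun j : Fin n => fun i => γ i ^ (j : ℕ)) := by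
  obtain ⟨p, hp⟩ := exists_poly_of_mem_span_pow O hx
  obtain ⟨q, hq⟩ := exists_poly_of_mem_span_pow O hy
  have h := eval_mem_span_pow O hγ (γ := γ) (p * q)
  have hxy : x * y = fun i => ((p * q).map O.subtype).eval (γ i) := by
    funext i; rw [Pi.mul_apply, ← hp i, ← hq i, Polynomial.map_mul, eval_mul]
  rwa [hxy]

/-- `O[γ]` is closed under componentwise powers. [cite: SerreLocalFields1979, Ch. III §6] -/
theorem pow_mem_span_pow (hγ : ∀ i, γ i ∈ O) {x : Fin n → K}
    (hx : x ∈ Submodule.span O (Set.range fun j : Fin n => fun i => γ i ^ (j : ℕ))) (m : ℕ) :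
    x ^ m ∈ Submodule.span O (Set.range fun j : Fin n => fun i => γ i ^ (j : ℕ)) := by
  induction m with
  | zero => rw [pow_zero]; exact one_mem_span_pow O hγ
  | succ m ih => rw [pow_succ]; exact mul_mem_span_pow O hγ ih hx

/-- Values of `O`-polynomials at an element of `O[γ]` stay in `O[γ]`. [cite: SerreLocalFields1979, Ch. III §6] -/
theorem eval_mem_span_pow_of_mem (hγ : ∀ i, γ i ∈ O) {x : Fin n → K}
    (hx : x ∈ Submodule.span O (Set.range fun j : Fin n => fun i => γ i ^ (j : ℕ))) (P : O[X]) :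
    (fun i => (P.map O.subtype).eval (x i)) ∈ Submodule.span O (Set.range fun j : Fin n => fun i => γ i ^ (j : ℕ)) := by
  have h : (fun i => (P.map O.subtype).eval (x i)) = ∑ k ∈ range (P.natDegree + 1), P.coeff k • x ^ k := by
    funext i
    rw [Polynomial.eval_map, Polynomial.eval₂_eq_sum_range, Finset.sum_apply]
    exact Finset.sum_congr rfl fun k _ => by rw [Pi.smul_apply, Pi.pow_apply, Subring.smul_def, smul_eq_mul, Subring.coe_subtype]
  rw [h]
  exact Submodule.sum_mem _ fun k _ => Submodule.smul_mem _ _ (pow_mem_span_pow O hγ hx k)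

/-- **Units of `O[γ]`**: an element of `O[γ]` whose components are units of `O` has its inverse in `O[γ]` (`x⁻¹ = −g(0)⁻¹·h(x)` for `g = ∏(X − x_i) = X·h + g(0)`).
[cite: SerreLocalFields1979, Ch. III §6] -/
theorem inv_mem_span_pow (hγ : ∀ i, γ i ∈ O) {x : Fin n → K}
    (hx : x ∈ Submodule.span O (Set.range fun j : Fin n => fun i => γ i ^ (j : ℕ))) (hxu : ∀ i, ∃ y ∈ O, y * x i = 1) :
    x⁻¹ ∈ Submodule.span O (Set.range fun j : Fin n => fun i => γ i ^ (j : ℕ)) := by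
  have hxO : ∀ i, x i ∈ O := apply_mem_of_mem_span_pow O hγ hx
  have hx0 : ∀ i, x i ≠ 0 := fun i h0 => by obtain ⟨y, -, hy⟩ := hxu i; rw [h0, mul_zero] at hy; exact zero_ne_one hy
  have hxinv : ∀ i, (x i)⁻¹ ∈ O := fun i => by
    obtain ⟨y, hy, hyx⟩ := hxu i
    rwa [← eq_inv_of_mul_eq_one_left hyx]
  -- `g = ∏ (X − x_i) ∈ O[X]`, `g = X · h + C g₀`, `g₀ = g.coeff 0`
  set g : O[X] := ∏ i : Fin n, (X - Polynomial.C (⟨x i, hxO i⟩ : O)) with hg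
  set h : O[X] := g.divX with hh
  have hsplit : h * X + Polynomial.C (g.coeff 0) = g := Polynomial.divX_mul_X_add g
  have hroot : ∀ i, (g.map O.subtype).eval (x i) = 0 := by
    intro i
    rw [hg, Polynomial.map_prod, Polynomial.eval_prod]
    exact Finset.prod_eq_zero (Finset.mem_univ i) (by simp)
  -- `g₀` is a unit of `O`: `g₀ = ∏ (−x_i)` and each `x_i` is a unit
  have hg0 : (g.coeff 0 : K) = ∏ i, (-(x i)) := by
    have : ((g.coeff 0 : O) : K) = (g.map O.subtype).coeff 0 := by rw [Polynomial.coeff_map]; rfl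
    rw [this, hg, Polynomial.map_prod, Polynomial.coeff_zero_eq_eval_zero, Polynomial.eval_prod]
    exact Finset.prod_congr rfl fun i _ => by simp
  have hg0inv : ((g.coeff 0 : O) : K)⁻¹ ∈ O := by
    rw [hg0, ← Finset.prod_inv_distrib]
    exact Subring.prod_mem _ fun i _ => by rw [inv_neg]; exact Subring.neg_mem _ (hxinv i)
  have hg0ne : ((g.coeff 0 : O) : K) ≠ 0 := by
    rw [hg0, Finset.prod_ne_zero_iff]
    exact fun i _ => neg_ne_zero.2 (hx0 i)
  -- `x_i⁻¹ = −g₀⁻¹ · h(x_i)`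
  have hinv : x⁻¹ = (⟨-((g.coeff 0 : O) : K)⁻¹, Subring.neg_mem _ hg0inv⟩ : O) • fun i => (h.map O.subtype).eval (x i) := by
    funext i
    have hi : (h.map O.subtype).eval (x i) * x i + (g.coeff 0 : K) = 0 := by
      have := congrArg (fun P : O[X] => (P.map O.subtype).eval (x i)) hsplit
      simp only [Polynomial.map_add, Polynomial.map_mul, Polynomial.map_X, Polynomial.map_C, eval_add, eval_mul, eval_X, eval_C,
        Subring.coe_subtype] at this
      rw [this, hroot i]
    have he : (h.map O.subtype).eval (x i) = -(g.coeff 0 : K) / x i := by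
      rw [eq_div_iff (hx0 i)]
      exact eq_neg_of_add_eq_zero_left hi
    rw [Pi.inv_apply, Pi.smul_apply, Subring.smul_def, smul_eq_mul, he]
    show (x i)⁻¹ = -((g.coeff 0 : O) : K)⁻¹ * (-((g.coeff 0 : O) : K) / x i)
    field_simp
  rw [hinv]
  exact Submodule.smul_mem _ _ (eval_mem_span_pow_of_mem O hγ hx h)

end Ring

/-! ## §2 Transport of the self-duality criterion along `a ↦ c • a`: the good set is a coset of `C = {c | c σ(c) ∈ O[γ]^×}` -/

section Transport

variable {K : Type*} [Field K] {n : ℕ} (O : Subring K) {γ : Fin n → K} (σ : K →+* K)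

/-- The criterion vector of `c • a` is `N(c)` times that of `a`: `d_i (c_i a_i) σ(c_i a_i) f′_i = (c_i σ(c_i)) · (d_i a_i σ(a_i) f′_i)`. [cite: Jacobowitz1962, §4] -/
theorem criterion_smul (d a c : Fin n → K) :
    (fun i => d i * (c i * a i) * σ (c i * a i) * ∏ j ∈ univ.erase i, (γ i - γ j)) =
      (fun i => c i * σ (c i)) * fun i => d i * a i * σ (a i) * ∏ j ∈ univ.erase i, (γ i - γ j) := by
  funext i
  simp only [Pi.mul_apply, map_mul]
  ring

/-- **Transport**: if the criterion vector of `a` lies in `O[γ]` and `N(c) = (c_i σ(c_i))_i ∈ O[γ]`, then the criterion vector of `c • a` lies in `O[γ]`. [cite: Jacobowitz1962, §4] -/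
theorem criterion_mem_of_norm_mem (hγ : ∀ i, γ i ∈ O) {d a c : Fin n → K}
    (ha : (fun i => d i * a i * σ (a i) * ∏ j ∈ univ.erase i, (γ i - γ j)) ∈ Submodule.span O (Set.range fun j : Fin n => fun i => γ i ^ (j : ℕ)))
    (hc : (fun i => c i * σ (c i)) ∈ Submodule.span O (Set.range fun j : Fin n => fun i => γ i ^ (j : ℕ))) :
    (fun i => d i * (c i * a i) * σ (c i * a i) * ∏ j ∈ univ.erase i, (γ i - γ j)) ∈
      Submodule.span O (Set.range fun j : Fin n => fun i => γ i ^ (j : ℕ)) := by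
  rw [criterion_smul]
  exact mul_mem_span_pow O hγ hc ha

/-- **Converse transport**: if the criterion vectors of `a` and `a′` both lie in `O[γ]` with unit components (the two cyclic lattices are self-dual) and `a` has non-zero
components, then `N(a′∕a) ∈ O[γ]` (with unit components): the good set is ONE coset of `C = {c | N(c) ∈ O[γ]^×}`. [cite: Jacobowitz1962, §4] -/
theorem norm_div_mem_of_criterion_mem (hγ : ∀ i, γ i ∈ O) {d a a' : Fin n → K}
    (ha : (fun i => d i * a i * σ (a i) * ∏ j ∈ univ.erase i, (γ i - γ j)) ∈ Submodule.span O (Set.range fun j : Fin n => fun i => γ i ^ (j : ℕ)))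
    (hau : ∀ i, ∃ y ∈ O, y * (d i * a i * σ (a i) * ∏ j ∈ univ.erase i, (γ i - γ j)) = 1)
    (ha' : (fun i => d i * a' i * σ (a' i) * ∏ j ∈ univ.erase i, (γ i - γ j)) ∈ Submodule.span O (Set.range fun j : Fin n => fun i => γ i ^ (j : ℕ))) :
    (fun i => (a' i / a i) * σ (a' i / a i)) ∈ Submodule.span O (Set.range fun j : Fin n => fun i => γ i ^ (j : ℕ)) := by
  have hinv := inv_mem_span_pow O hγ ha hau
  have hmul := mul_mem_span_pow O hγ ha' hinv
  have heq : (fun i => (a' i / a i) * σ (a' i / a i)) =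
      (fun i => d i * a' i * σ (a' i) * ∏ j ∈ univ.erase i, (γ i - γ j)) * (fun i => d i * a i * σ (a i) * ∏ j ∈ univ.erase i, (γ i - γ j))⁻¹ := by
    funext i
    have hne : d i * a i * σ (a i) * ∏ j ∈ univ.erase i, (γ i - γ j) ≠ 0 := fun h0 => by
      obtain ⟨y, -, hy⟩ := hau i; rw [h0, mul_zero] at hy; exact zero_ne_one hy
    have hd : d i ≠ 0 := fun h0 => hne (by rw [h0]; ring)
    have ha : a i ≠ 0 := fun h0 => hne (by rw [h0]; ring)
    have hs : σ (a i) ≠ 0 := fun h0 => hne (by rw [h0]; ring)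
    have hf : ∏ j ∈ univ.erase i, (γ i - γ j) ≠ 0 := fun h0 => hne (by rw [h0]; ring)
    simp only [Pi.mul_apply, Pi.inv_apply, map_div₀]
    field_simp
  rw [heq]
  exact hmul

end Transport

/-! ## §3 The cyclic lattice `O[γ]·a` depends only on `a` modulo `O[γ]^×` -/

section Lattice

variable {K : Type*} [Field K] {n : ℕ} (O : Subring K) {γ : Fin n → K}

/-- `O[γ]·a = (O[γ]).map (· * a)`: the cyclic lattice spanned by `{γ^j a}` is the image of the order under multiplication by `a`. [cite: SerreLocalFields1979, Ch. III §6] -/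
theorem span_pow_mul_eq_map (a : Fin n → K) :
    Submodule.span O (Set.range fun j : Fin n => fun i => γ i ^ (j : ℕ) * a i) =
      (Submodule.span O (Set.range fun j : Fin n => fun i => γ i ^ (j : ℕ))).map
        ((LinearMap.mulRight K a).restrictScalars O) := by
  rw [Submodule.map_span, ← Set.range_comp]
  rfl

/-- **`O[γ]·(u a) = O[γ]·a` for a unit `u` of `O[γ]`** (`u, u⁻¹ ∈ O[γ]`). [cite: SerreLocalFields1979, Ch. III §6] -/
theorem span_pow_mul_eq_of_unit (hγ : ∀ i, γ i ∈ O) {u : Fin n → K} (a : Fin n → K)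
    (hu : u ∈ Submodule.span O (Set.range fun j : Fin n => fun i => γ i ^ (j : ℕ)))
    (hu' : u⁻¹ ∈ Submodule.span O (Set.range fun j : Fin n => fun i => γ i ^ (j : ℕ))) (hu0 : ∀ i, u i ≠ 0) :
    Submodule.span O (Set.range fun j : Fin n => fun i => γ i ^ (j : ℕ) * (u i * a i)) =
      Submodule.span O (Set.range fun j : Fin n => fun i => γ i ^ (j : ℕ) * a i) := by
  apply le_antisymm
  · rw [Submodule.span_le]
    rintro _ ⟨j, rfl⟩
    have hmem : (fun i => γ i ^ (j : ℕ)) * u ∈ Submodule.span O (Set.range fun j : Fin n => fun i => γ i ^ (j : ℕ)) :=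
      mul_mem_span_pow O hγ (Submodule.subset_span ⟨j, rfl⟩) hu
    have : (fun i => γ i ^ (j : ℕ) * (u i * a i)) = ((LinearMap.mulRight K a).restrictScalars O) ((fun i => γ i ^ (j : ℕ)) * u) := by
      funext i; simp [mul_assoc]
    change (fun i => γ i ^ (j : ℕ) * (u i * a i)) ∈ (Submodule.span O (Set.range fun j : Fin n => fun i => γ i ^ (j : ℕ) * a i) : Set (Fin n → K))
    rw [this, SetLike.mem_coe, span_pow_mul_eq_map]
    exact Submodule.mem_map_of_mem hmem
  · rw [Submodule.span_le]
    rintro _ ⟨j, rfl⟩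
    have hmem : (fun i => γ i ^ (j : ℕ)) * u⁻¹ ∈ Submodule.span O (Set.range fun j : Fin n => fun i => γ i ^ (j : ℕ)) :=
      mul_mem_span_pow O hγ (Submodule.subset_span ⟨j, rfl⟩) hu'
    have : (fun i => γ i ^ (j : ℕ) * a i) = ((LinearMap.mulRight K (u * a)).restrictScalars O) ((fun i => γ i ^ (j : ℕ)) * u⁻¹) := by
      funext i; simp [mul_assoc, inv_mul_cancel_left₀ (hu0 i)]
    change (fun i => γ i ^ (j : ℕ) * a i) ∈ (Submodule.span O (Set.range fun j : Fin n => fun i => γ i ^ (j : ℕ) * (u i * a i)) : Set (Fin n → K))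
    rw [this, SetLike.mem_coe, show (fun j : Fin n => fun i => γ i ^ (j : ℕ) * (u i * a i)) = fun j : Fin n => fun i => γ i ^ (j : ℕ) * (u * a) i from rfl,
      span_pow_mul_eq_map]
    exact Submodule.mem_map_of_mem hmem

/-- **Conversely, `O[γ]·a = O[γ]·a′` with `a_i ≠ 0` forces `a′∕a ∈ O[γ]^×`** (both `a′∕a` and `a∕a′` lie in `O[γ]`). [cite: SerreLocalFields1979, Ch. III §6] -/
theorem div_mem_span_pow_of_span_eq (hγ : ∀ i, γ i ∈ O) {a a' : Fin n → K} (ha0 : ∀ i, a i ≠ 0)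
    (h : Submodule.span O (Set.range fun j : Fin n => fun i => γ i ^ (j : ℕ) * a' i) =
      Submodule.span O (Set.range fun j : Fin n => fun i => γ i ^ (j : ℕ) * a i)) :
    (fun i => a' i / a i) ∈ Submodule.span O (Set.range fun j : Fin n => fun i => γ i ^ (j : ℕ)) := by
  rcases Nat.eq_zero_or_pos n with hn | hn
  · subst hn
    have h0 : (fun i : Fin 0 => a' i / a i) = 0 := funext fun i => Fin.elim0 i
    rw [h0]; exact Submodule.zero_mem _
  -- `a′ = γ^0 · a′ ∈ O[γ]·a′ = O[γ]·a`, so `a′ = x · a` with `x ∈ O[γ]`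
  have ha' : a' ∈ Submodule.span O (Set.range fun j : Fin n => fun i => γ i ^ (j : ℕ) * a i) := by
    rw [← h]
    refine Submodule.subset_span ⟨⟨0, hn⟩, ?_⟩
    funext i; simp
  rw [span_pow_mul_eq_map, Submodule.mem_map] at ha'
  obtain ⟨x, hx, hxa⟩ := ha'
  have : (fun i => a' i / a i) = x := by
    funext i
    have := congrFun hxa i
    simp only [LinearMap.coe_restrictScalars, LinearMap.mulRight_apply, Pi.mul_apply] at this
    rw [← this, mul_div_cancel_right₀ _ (ha0 i)]
  rw [this]
  exact hx

end Lattice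

end Literature.NumberTheory.Automorphic
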